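import Literature.Probability.Percolation.QuadCrossingNoise
import Literature.Probability.Percolation.QuadCrossingContinuityEvents
import Mathlib.MeasureTheory.Measure.Portmanteau
import Mathlib.MeasureTheory.MeasurableSpace.EventuallyMeasurable
import Mathlib.MeasureTheory.OuterMeasure.BorelCantelli
import HarnessLib

/-!
# Towards Schramm–Smirnov 2011, Theorem 1.7 (Factorization): the glue of the printed proof

Topic `Literature/Probability/Percolation`; proofs file for the named fact
`SchrammSmirnov2011_thm_1_7` of `QuadCrossingNoise.lean` (O. Schramm, S. Smirnov, *On the scaling
limits of planar percolation*, Ann. Probab. 39 (2011) 1768–1814, arXiv:1101.5820, Thm. 1.7).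

**The printed proof (p. 21 of the arXiv version, read).**  "Clearly, `𝓕_{D∖α} = ∨_j 𝓕_{D_j}`.  It
therefore remains to prove the left-hand equality stated in the theorem.  Note that we work up to
sets of `μ`-measure zero.  Take a smooth (given by a diffeomorphism) quad `Q₀ ∈ 𝒬_D`.  By
Proposition 4.1 [mesh-independent gluing] and Corollary 5.2 [`μ(𝓜) = lim μ_η(𝓜)` for `𝓜` in the
Boolean algebra of finitely many crossing events, from Lemma 5.1 and the portmanteau theorem], we
have `⊞_{Q₀} ∈ 𝓕_{D∖α}` (5.2).  Since such collection of quads is dense in `𝒬_D`, Theorem 1.7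
follows from Proposition [Theorem 1.4] (2)."

This file PROVES that architecture, i.e. everything in the proof of Theorem 1.7 except its two
percolation inputs — Proposition 4.1 ("the most technically difficult part of our paper", §4, resting
on the discrete gluing Theorem 1.1 of §2 and the RSW/pivotal Assumptions 1.1) and Lemma 5.1 (the
named fact `SchrammSmirnov2011_lemma_5_1` of `QuadCrossingContinuityEvents.lean`, §6):

* `aeIncluded_iff_le_eventuallyMeasurableSpace`, `AEIncluded.generateFrom`, `AEIncluded.sup`:
  "we work up to sets of measure zero" — inclusion of `σ`-fields mod `μ` is inclusion into Mathlib's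
  `eventuallyMeasurableSpace m (ae μ)`, so it can be checked on generators;
* `crossingField_diff_eq_iSup` : `𝓕_{D∖α} = ∨_j 𝓕_{D_j}` ("Clearly"): a quad is connected, so a quad
  inside `D ∖ α` lies inside one component;
* `aeIncluded_borel_of_dense`, `aeIncluded_iSup_crossingField_of_dense`: by Theorem 1.4 (2)
  (the named fact `SchrammSmirnov2011_thm_1_4` of `QuadCrossingSpace.lean`, taken as the hypothesis
  `h14` and discharged in the tree by `SchrammSmirnov2011_thm_1_4_holds` of
  `QuadCrossingSpaceProofs.lean`, which is deliberately not imported here to keep this file off the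
  plane-topology stack) the conclusion of Theorem 1.7 for `(D, μ, α)` follows from (5.2) for the
  quads of any dense `A ⊆ 𝒬_D`;
* `exists_measurableSet_ae_eq_of_forall_approx`: a set approximable in `μ`-measure by `m`-measurable
  sets is `μ`-a.e. equal to an `m`-measurable set (Borel–Cantelli; the implicit last step of (5.2));
* `finiteMeasure_tendsto_measure_of_null_frontier` (portmanteau for weakly convergent FINITE
  measures and continuity sets, by normalisation to Mathlib's probability-measure version),
  `hasOuterApproxClosed_of_thm_1_4` (`ℋ_D` is metrizable, Thm. 1.4 (1)),
  `measure_frontier_eq_zero_of_generateFrom_finite` (the `σ`-field of finitely many continuity sets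
  consists of continuity sets) and `SchrammSmirnov2011_lemma_5_1.tendsto_measure` — Corollary 5.2
  from Lemma 5.1;
* `SchrammSmirnov2011_lemma_5_1.exists_measurableSet_crossingField_ae_eq_of_gluing` — (5.2) for a
  quad `Q₀` from the conclusion of Proposition 4.1 for `Q₀` (along the sequence of meshes defining
  the subsequential limit) and Lemma 5.1.

What then remains of Theorem 1.7 is exactly Proposition 4.1 for a dense family of quads and
Lemma 5.1 (plus `SchrammSmirnov2011_thm_1_4_holds` for `h14`); no statement of either is introduced
here (D-0026).

## References

* O. Schramm, S. Smirnov, Ann. Probab. 39 (2011) 1768–1814, arXiv:1101.5820: Thm. 1.4 (2), Thm. 1.7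
  and its proof (§5, p. 21), Prop. 4.1, Lemma 5.1, Cor. 5.2. [SchrammSmirnov2011]
* R. M. Dudley, *Real Analysis and Probability*, Thm. 11.1.1 (portmanteau), as cited loc. cit.
-/

noncomputable section

open scoped Topology unitInterval ENNReal NNReal symmDiff
open Set Filter MeasureTheory

namespace Literature.Probability.Percolation

namespace QuadCrossing

/-! ### Inclusion of `σ`-fields modulo null sets: reduction to generators -/

section AE

variable {Ω : Type*} {mΩ : MeasurableSpace Ω} {μ : Measure Ω}

/-- `m₁ ⊆ m₂ (mod μ)` is the inclusion of `m₁` in the `σ`-field of sets `μ`-a.e. equal to an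
`m₂`-measurable set (Mathlib's `eventuallyMeasurableSpace m₂ (ae μ)`). [folklore] -/
theorem aeIncluded_iff_le_eventuallyMeasurableSpace {m₁ m₂ : MeasurableSpace Ω} :
    AEIncluded μ m₁ m₂ ↔ m₁ ≤ eventuallyMeasurableSpace m₂ (ae μ) :=
  Iff.rfl

/-- **"We work up to sets of measure zero"**: to prove `σ(S) ⊆ m (mod μ)` it suffices to treat the
generators. [cite: SchrammSmirnov2011, proof of Thm. 1.7] -/
theorem AEIncluded.generateFrom {S : Set (Set Ω)} {m : MeasurableSpace Ω}
    (h : ∀ s ∈ S, ∃ t, MeasurableSet[m] t ∧ s =ᵐ[μ] t) :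
    AEIncluded μ (MeasurableSpace.generateFrom S) m :=
  aeIncluded_iff_le_eventuallyMeasurableSpace.2 (MeasurableSpace.generateFrom_le h)

/-- Joins: `m₁ ⊆ m`, `m₂ ⊆ m (mod μ)` give `m₁ ∨ m₂ ⊆ m (mod μ)`. [folklore] -/
theorem AEIncluded.sup {m₁ m₂ m : MeasurableSpace Ω} (h₁ : AEIncluded μ m₁ m)
    (h₂ : AEIncluded μ m₂ m) : AEIncluded μ (m₁ ⊔ m₂) m :=
  aeIncluded_iff_le_eventuallyMeasurableSpace.2
    (sup_le (aeIncluded_iff_le_eventuallyMeasurableSpace.1 h₁)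
      (aeIncluded_iff_le_eventuallyMeasurableSpace.1 h₂))

/-- Indexed joins: `mᵢ ⊆ m (mod μ)` for all `i` gives `∨ᵢ mᵢ ⊆ m (mod μ)`. [folklore] -/
theorem AEIncluded.iSup {ι : Sort*} {m : ι → MeasurableSpace Ω} {m' : MeasurableSpace Ω}
    (h : ∀ i, AEIncluded μ (m i) m') : AEIncluded μ (⨆ i, m i) m' :=
  aeIncluded_iff_le_eventuallyMeasurableSpace.2
    (iSup_le fun i => aeIncluded_iff_le_eventuallyMeasurableSpace.1 (h i))

/-- Monotonicity in the target. [folklore] -/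
theorem AEIncluded.mono_right {m₁ m₂ m₃ : MeasurableSpace Ω} (h : AEIncluded μ m₁ m₂)
    (h' : m₂ ≤ m₃) : AEIncluded μ m₁ m₃ :=
  h.trans (AEIncluded.of_le h')

/-- **Approximation in measure gives a.e. membership** (the implicit last step of (5.2) in the
proof of Thm. 1.7): if for every `ε > 0` the set `s` is within `μ`-measure `ε` (symmetric
difference) of some `m`-measurable set, then `s` is `μ`-a.e. equal to an `m`-measurable set — with
`μ (s ∆ tₙ) ≤ 2⁻ⁿ`, `t = liminf tₙ` works by Borel–Cantelli. [folklore] -/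
theorem exists_measurableSet_ae_eq_of_forall_approx {m : MeasurableSpace Ω} {s : Set Ω}
    (h : ∀ ε : ℝ, 0 < ε → ∃ t, MeasurableSet[m] t ∧ μ (s ∆ t) ≤ ENNReal.ofReal ε) :
    ∃ t, MeasurableSet[m] t ∧ s =ᵐ[μ] t := by
  -- `εₙ = 2⁻ⁿ`
  have hε_top : ∀ n : ℕ, (2⁻¹ : ℝ≥0∞) ^ n ≠ ∞ := fun n =>
    ENNReal.pow_ne_top (ENNReal.inv_ne_top.2 two_ne_zero)
  have hε_pos : ∀ n : ℕ, 0 < ((2⁻¹ : ℝ≥0∞) ^ n).toReal := fun n =>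
    ENNReal.toReal_pos (pow_ne_zero _ (ENNReal.inv_ne_zero.2 ENNReal.ofNat_ne_top)) (hε_top n)
  choose t ht hst using fun n : ℕ => h (((2⁻¹ : ℝ≥0∞) ^ n).toReal) (hε_pos n)
  have hst' : ∀ n, μ (s ∆ t n) ≤ (2⁻¹ : ℝ≥0∞) ^ n := fun n => by
    simpa only [ENNReal.ofReal_toReal (hε_top n)] using hst n
  refine ⟨Filter.liminf t atTop, @MeasurableSet.measurableSet_liminf Ω m t ht, ?_⟩
  -- `s ∆ liminf tₙ ⊆ limsup (s ∆ tₙ)`, a null set by Borel–Cantelli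
  have hsum : ∑' n, μ (s ∆ t n) ≠ ∞ := by
    refine ne_top_of_le_ne_top ?_ (ENNReal.tsum_le_tsum hst')
    rw [ENNReal.tsum_geometric, ENNReal.one_sub_inv_two, inv_inv]
    exact ENNReal.ofNat_ne_top
  have hnull : μ (Filter.limsup (fun n => s ∆ t n) atTop) = 0 := measure_limsup_atTop_eq_zero hsum
  refine measure_symmDiff_eq_zero_iff.1 (measure_mono_null ?_ hnull)
  intro x hx
  rw [Filter.mem_limsup_iff_frequently_mem]
  rcases hx with ⟨hxs, hxt⟩ | ⟨hxt, hxs⟩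
  · -- `x ∈ s`, `x ∉ liminf tₙ`: `x ∉ tₙ` frequently
    have hfr : ∃ᶠ n in atTop, x ∉ t n := by
      rw [Filter.mem_liminf_iff_eventually_mem] at hxt
      exact Filter.not_eventually.1 hxt
    exact hfr.mono fun n hn => Or.inl ⟨hxs, hn⟩
  · -- `x ∉ s`, `x ∈ liminf tₙ`: `x ∈ tₙ` eventually
    rw [Filter.mem_liminf_iff_eventually_mem] at hxt
    exact (hxt.mono fun n hn => Or.inr ⟨hn, hxs⟩).frequently

end AE

/-! ### `𝓕_{D∖α} = ∨_j 𝓕_{D_j}` ("Clearly") -/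

variable {D : Set ℂ}

/-- A quad is connected: `[Q]` lies in the connected component (in `U`) of each of its points, as
soon as `[Q] ⊆ U`. [folklore] -/
theorem Quad.carrier_subset_connectedComponentIn (Q : Quad D) {U : Set ℂ} (hQ : Q.carrier ⊆ U)
    {x : ℂ} (hx : x ∈ Q.carrier) : Q.carrier ⊆ connectedComponentIn U x :=
  (isPreconnected_range Q.continuous_toFun).subset_connectedComponentIn hx hQ

/-- The tautological inclusion `∨_{x ∈ U} 𝓕_{C(x)} ≤ 𝓕_U`, `C(x)` the component of `x` in `U`.
[cite: SchrammSmirnov2011, proof of Thm. 1.7 ("Clearly")] -/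
theorem iSup_crossingField_connectedComponentIn_le (U : Set ℂ) :
    (⨆ x ∈ U, crossingField (D := D) (connectedComponentIn U x)) ≤ crossingField (D := D) U :=
  iSup₂_le fun x _ => crossingField_mono (connectedComponentIn_subset U x)

/-- **`𝓕_U = ∨_{x ∈ U} 𝓕_{C(x)}`** ("Clearly, `𝓕_{D∖α} = ∨_j 𝓕_{D_j}`", `D_j` the components of
`D ∖ α`): a quad inside `U` is connected, hence inside the component of its corner `Q(0,0)`.
[cite: SchrammSmirnov2011, proof of Thm. 1.7] -/
theorem crossingField_eq_iSup_connectedComponentIn (U : Set ℂ) :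
    crossingField (D := D) U = ⨆ x ∈ U, crossingField (D := D) (connectedComponentIn U x) := by
  refine le_antisymm (MeasurableSpace.generateFrom_le ?_)
    (iSup_crossingField_connectedComponentIn_le U)
  rintro _ ⟨Q, hQ, rfl⟩
  have hx : Q ((0 : I), (0 : I)) ∈ Q.carrier := ⟨((0 : I), (0 : I)), rfl⟩
  have hle : crossingField (D := D) (connectedComponentIn U (Q ((0 : I), (0 : I)))) ≤
      ⨆ x ∈ U, crossingField (D := D) (connectedComponentIn U x) :=
    le_iSup₂ (f := fun x (_ : x ∈ U) => crossingField (D := D) (connectedComponentIn U x))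
      (Q ((0 : I), (0 : I))) (hQ hx)
  exact hle _ (measurableSet_crossingField_crossedEvent
    (Q.carrier_subset_connectedComponentIn hQ hx))

/-- The instance used in the statement of Thm. 1.7: `𝓕_{D∖α} = ∨_{x ∈ D∖α} 𝓕_{C(x)}`.
[cite: SchrammSmirnov2011, proof of Thm. 1.7] -/
theorem crossingField_diff_eq_iSup (D α : Set ℂ) :
    crossingField (D := D) (D \ α) =
      ⨆ x ∈ D \ α, crossingField (D := D) (connectedComponentIn (D \ α) x) :=
  crossingField_eq_iSup_connectedComponentIn (D \ α)

/-! ### Reduction to a dense family of quads (Theorem 1.4 (2)) -/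

/-- **Reduction to generators**: if the crossing event of every quad of a dense `A ⊆ 𝒬_D` is
`μ`-a.e. equal to an `m`-measurable set, then so is every Borel set of `ℋ_D` — because the
`V^Q = ¬⊞_Q`, `Q ∈ A`, generate the Borel `σ`-field (Thm. 1.4 (2), hypothesis `h14`, discharged by
`SchrammSmirnov2011_thm_1_4_holds`).
[cite: SchrammSmirnov2011, proof of Thm. 1.7 ("Theorem follows from Thm. 1.4 (2)")] -/
theorem aeIncluded_borel_of_dense (h14 : SchrammSmirnov2011_thm_1_4) (hD : IsOpen D)
    (hne : D.Nonempty) (μ : Measure (QuadConfig D)) {m : MeasurableSpace (QuadConfig D)}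
    {A : Set (Quad D)} (hA : Dense A)
    (h : ∀ Q ∈ A, ∃ t, MeasurableSet[m] t ∧ QuadConfig.crossedEvent Q =ᵐ[μ] t) :
    AEIncluded μ (borel (QuadConfig D)) m := by
  have hgen := ((h14 D hD hne).2 A hA).2
  rw [← hgen]
  refine AEIncluded.generateFrom ?_
  rintro _ ⟨Q, hQ, rfl⟩
  obtain ⟨t, ht, hQt⟩ := h Q hQ
  refine ⟨tᶜ, ht.compl, ?_⟩
  show QuadConfig.notCrossed Q =ᵐ[μ] tᶜ
  rw [← QuadConfig.compl_crossedEvent]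
  exact hQt.compl

/-- **Theorem 1.7 for `(D, μ, α)` from (5.2) on a dense family**: if `⊞_Q` is `μ`-a.e. equal to an
`𝓕_{D∖α}`-measurable set for every quad `Q` of a dense `A ⊆ 𝒬_D` ("such collection of quads is
dense in `𝒬_D`"), then every Borel set of `ℋ_D` is `μ`-a.e. equal to a set measurable for
`∨_{x ∈ D∖α} 𝓕_{C(x)}` — the conclusion of `SchrammSmirnov2011_thm_1_7` for `(D, μ, α)`.
[cite: SchrammSmirnov2011, proof of Thm. 1.7] -/
theorem aeIncluded_iSup_crossingField_of_dense (h14 : SchrammSmirnov2011_thm_1_4) (hD : IsOpen D)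
    (hne : D.Nonempty) (μ : Measure (QuadConfig D)) (α : Set ℂ) {A : Set (Quad D)} (hA : Dense A)
    (h : ∀ Q ∈ A, ∃ t, MeasurableSet[crossingField (D \ α)] t ∧
      QuadConfig.crossedEvent Q =ᵐ[μ] t) :
    AEIncluded μ (inferInstance : MeasurableSpace (QuadConfig D))
      (⨆ x ∈ D \ α, crossingField (connectedComponentIn (D \ α) x)) := by
  rw [← crossingField_diff_eq_iSup]
  exact aeIncluded_borel_of_dense h14 hD hne μ hA h

/-! ### Portmanteau for weakly convergent finite measures and continuity sets -/

section Portmanteau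

variable {Ω ι : Type*} {L : Filter ι} [MeasurableSpace Ω] [TopologicalSpace Ω]
  [OpensMeasurableSpace Ω] [HasOuterApproxClosed Ω] [Nonempty Ω]

/-- **Portmanteau for finite measures**: if `μs → μ` weakly (finite Borel measures on a space
with `HasOuterApproxClosed`, e.g. a metrizable one) and `μ(∂E) = 0`, then `μs i (E) → μ(E)`.
(Mathlib has the probability-measure version; normalise by the total masses, which converge.)
[cite: SchrammSmirnov2011, Cor. 5.2 (portmanteau, Dudley Thm. 11.1.1)] -/
theorem finiteMeasure_tendsto_measure_of_null_frontier {μ : FiniteMeasure Ω}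
    {μs : ι → FiniteMeasure Ω} (hlim : Tendsto μs L (𝓝 μ)) {E : Set Ω}
    (hE : (μ : Measure Ω) (frontier E) = 0) :
    Tendsto (fun i => μs i E) L (𝓝 (μ E)) := by
  by_cases hμ : μ = 0
  · subst hμ
    have h0 : Tendsto (fun i => (μs i).mass) L (𝓝 0) := by
      simpa only [FiniteMeasure.zero_mass] using hlim.mass
    simp only [FiniteMeasure.coeFn_zero, Pi.zero_apply]
    exact tendsto_of_tendsto_of_tendsto_of_le_of_le tendsto_const_nhds h0 (fun i => zero_le)
      fun i => (μs i).apply_le_mass E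
  · have hν : Tendsto (fun i => (μs i).normalize) L (𝓝 μ.normalize) :=
      μ.tendsto_normalize_of_tendsto hlim hμ
    have hνE : (μ.normalize : Measure Ω) (frontier E) = 0 := by
      rw [μ.toMeasure_normalize_eq_of_nonzero hμ, Measure.smul_apply, hE, smul_zero]
    have key := ProbabilityMeasure.tendsto_measure_of_null_frontier_of_tendsto hν
      ((ProbabilityMeasure.null_iff_toMeasure_null _ _).2 hνE)
    have := hlim.mass.mul key
    simpa only [← FiniteMeasure.self_eq_mass_mul_normalize] using this

/-- The same, with values in `ℝ≥0∞` (measures of the underlying `Measure`s).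
[cite: SchrammSmirnov2011, Cor. 5.2 (portmanteau)] -/
theorem finiteMeasure_tendsto_measure_of_null_frontier' {μ : FiniteMeasure Ω}
    {μs : ι → FiniteMeasure Ω} (hlim : Tendsto μs L (𝓝 μ)) {E : Set Ω}
    (hE : (μ : Measure Ω) (frontier E) = 0) :
    Tendsto (fun i => (μs i : Measure Ω) E) L (𝓝 ((μ : Measure Ω) E)) := by
  have := ENNReal.tendsto_coe.2 (finiteMeasure_tendsto_measure_of_null_frontier hlim hE)
  simpa only [FiniteMeasure.ennreal_coeFn_eq_coeFn_toMeasure] using this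

end Portmanteau

/-! ### The `σ`-field of finitely many continuity sets consists of continuity sets -/

section FiniteField

variable {Ω : Type*}

/-- Adding one generator: every set of `σ(C ∪ {a})` is `(E₁ ∩ a) ∪ (E₂ ∖ a)` with
`E₁, E₂ ∈ σ(C)`. [folklore] -/
theorem exists_eq_of_measurableSet_generateFrom_insert {C : Set (Set Ω)} {a E : Set Ω}
    (hE : MeasurableSet[MeasurableSpace.generateFrom (insert a C)] E) :
    ∃ E₁ E₂, MeasurableSet[MeasurableSpace.generateFrom C] E₁ ∧
      MeasurableSet[MeasurableSpace.generateFrom C] E₂ ∧ E = (E₁ ∩ a) ∪ (E₂ \ a) := by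
  induction E, hE using MeasurableSpace.generateFrom_induction with
  | hC t ht _ =>
    rcases Set.mem_insert_iff.1 ht with rfl | htC
    · exact ⟨univ, ∅, MeasurableSet.univ, MeasurableSpace.measurableSet_empty _, by simp⟩
    · exact ⟨t, t, MeasurableSpace.measurableSet_generateFrom htC,
        MeasurableSpace.measurableSet_generateFrom htC, (Set.inter_union_sdiff t a).symm⟩
  | empty =>
    exact ⟨∅, ∅, MeasurableSpace.measurableSet_empty _, MeasurableSpace.measurableSet_empty _,
      by simp⟩
  | compl t _ ih =>
    obtain ⟨E₁, E₂, h₁, h₂, rfl⟩ := ih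
    refine ⟨E₁ᶜ, E₂ᶜ, h₁.compl, h₂.compl, ?_⟩
    ext x
    by_cases hx : x ∈ a <;> simp [hx]
  | iUnion f _ ih =>
    choose E₁ E₂ h₁ h₂ hf using ih
    refine ⟨⋃ n, E₁ n, ⋃ n, E₂ n, MeasurableSet.iUnion h₁, MeasurableSet.iUnion h₂, ?_⟩
    ext x
    simp only [mem_iUnion, hf, mem_union, mem_inter_iff, Set.mem_sdiff]
    by_cases hx : x ∈ a <;> simp [hx]

variable [TopologicalSpace Ω] [MeasurableSpace Ω]

/-- **Finitely many continuity sets generate a `σ`-field of continuity sets**: if `C` is finite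
and `μ(∂s) = 0` for all `s ∈ C`, then `μ(∂E) = 0` for every `E ∈ σ(C)` (`σ(C)` is then the finite
Boolean algebra generated by `C`; induction on `C`, adding one generator at a time).  This is
"Lemma 5.1 implies `μ₀(∂𝓜) = 0`" in the proof of Cor. 5.2. [cite: SchrammSmirnov2011, Cor. 5.2 (proof)] -/
theorem measure_frontier_eq_zero_of_generateFrom_finite (μ : Measure Ω) {C : Set (Set Ω)}
    (hC : C.Finite) (h : ∀ s ∈ C, μ (frontier s) = 0) {E : Set Ω}
    (hE : MeasurableSet[MeasurableSpace.generateFrom C] E) : μ (frontier E) = 0 := by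
  refine Set.Finite.induction_on
    (motive := fun C _ => ∀ E, (∀ s ∈ C, μ (frontier s) = 0) →
      MeasurableSet[MeasurableSpace.generateFrom C] E → μ (frontier E) = 0) C hC ?_ ?_ E h hE
  · intro E _ hE
    rw [MeasurableSpace.generateFrom_empty, MeasurableSpace.measurableSet_bot_iff] at hE
    rcases hE with rfl | rfl <;> simp
  · intro a C _ _ ih E h hE
    obtain ⟨E₁, E₂, h₁, h₂, rfl⟩ := exists_eq_of_measurableSet_generateFrom_insert hE
    have ha : μ (frontier a) = 0 := h a (mem_insert a C)
    have ih' : ∀ E', MeasurableSet[MeasurableSpace.generateFrom C] E' → μ (frontier E') = 0 :=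
      fun E' hE' => ih E' (fun s hs => h s (mem_insert_of_mem a hs)) hE'
    refine measure_frontier_union_eq_zero μ (measure_frontier_inter_eq_zero μ (ih' E₁ h₁) ha) ?_
    rw [Set.sdiff_eq]
    exact measure_frontier_inter_eq_zero μ (ih' E₂ h₂) (measure_frontier_compl_eq_zero μ ha)

end FiniteField

/-! ### Corollary 5.2 from Lemma 5.1, and (5.2) from Proposition 4.1 -/

/-- `ℋ_D` has Mathlib's `HasOuterApproxClosed` (it is metrizable: Thm. 1.4 (1), hypothesis `h14`),
so the portmanteau theorem applies to weak limits in `ℋ_D`, `D` open nonempty.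
[cite: SchrammSmirnov2011, Thm. 1.4 (1) and Cor. 1.5] -/
theorem hasOuterApproxClosed_of_thm_1_4 (h14 : SchrammSmirnov2011_thm_1_4) (hD : IsOpen D)
    (hne : D.Nonempty) : HasOuterApproxClosed (QuadConfig D) := by
  haveI : TopologicalSpace.MetrizableSpace (QuadConfig D) := (h14 D hD hne).1.2.1
  infer_instance

/-- **Corollary 5.2 (from Lemma 5.1).**  "If `𝓜 ⊂ ℋ_D` is in the Boolean algebra generated by
finitely many of the events `⊞_Q`, `Q ∈ 𝒬_D` …, then `μ(𝓜) = lim_{|η|→0} μ_η(𝓜)`": for `μ` the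
weak limit of the laws `μ_{δₖ}` of critical bond percolation on `δₖℤ²` (`δₖ → 0⁺`) in `ℋ_D`, `D`
open nonempty, and `E` measurable with respect to finitely many crossing events,
`μ_{δₖ}(E) → μ(E)` — given Lemma 5.1 (`h51`) and Thm. 1.4 (`h14`, metrizability), by
`measure_frontier_eq_zero_of_generateFrom_finite` and the portmanteau theorem.
[cite: SchrammSmirnov2011, Cor. 5.2] -/
theorem SchrammSmirnov2011_lemma_5_1.tendsto_measure (h51 : SchrammSmirnov2011_lemma_5_1)
    (h14 : SchrammSmirnov2011_thm_1_4) (hD : IsOpen D) (hne : D.Nonempty)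
    {μ : FiniteMeasure (QuadConfig D)} {δs : ℕ → ℝ}
    (hpos : ∀ k, 0 < δs k) (h0 : Tendsto δs atTop (𝓝 0))
    (hlim : Tendsto (fun k => squareCrossingLaw D (δs k)) atTop (𝓝 μ))
    {F : Set (Quad D)} (hF : F.Finite) {E : Set (QuadConfig D)}
    (hE : MeasurableSet[MeasurableSpace.generateFrom
      ((fun Q => QuadConfig.crossedEvent Q) '' F)] E) :
    Tendsto (fun k => (squareCrossingLaw D (δs k) : Measure (QuadConfig D)) E) atTop
      (𝓝 ((μ : Measure (QuadConfig D)) E)) := by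
  haveI := hasOuterApproxClosed_of_thm_1_4 h14 hD hne
  haveI : Nonempty (QuadConfig D) := ⟨QuadConfig.none⟩
  refine finiteMeasure_tendsto_measure_of_null_frontier' hlim ?_
  refine measure_frontier_eq_zero_of_generateFrom_finite _ (hF.image _) ?_ hE
  rintro _ ⟨Q, -, rfl⟩
  exact h51 D hD hne μ ⟨δs, hpos, h0, hlim⟩ Q

/-- **(5.2) from Proposition 4.1 and Corollary 5.2.**  Let `μ` be the weak limit of `μ_{δₖ}`
(`δₖ → 0⁺`) in `ℋ_D`, `D` open nonempty, and `Q₀ ∈ 𝒬_D`.  Suppose (the conclusion of Prop. 4.1,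
mesh-independent gluing, for `Q₀` and the region `U`, e.g. `U = D ∖ α`): for every `ε > 0` there
are a finite set `F` of quads inside `U` and an event `W`, measurable with respect to
`σ(⊞_Q : Q ∈ F)`, with `limsup_k μ_{δₖ}(W ∆ ⊞_{Q₀}) ≤ ε`.  Then, given Lemma 5.1 (`h51`), `⊞_{Q₀}`
is `μ`-a.e. equal to an `𝓕_U`-measurable set ("`⊞_{Q₀} ∈ 𝓕_{D∖α}`" up to null sets): by
Cor. 5.2 (with `h14`, Thm. 1.4) applied in `σ(⊞_Q : Q ∈ F ∪ {Q₀})`,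
`μ(W ∆ ⊞_{Q₀}) = lim_k μ_{δₖ}(W ∆ ⊞_{Q₀}) ≤ ε`, and `exists_measurableSet_ae_eq_of_forall_approx`.
[cite: SchrammSmirnov2011, proof of Thm. 1.7 (eq. (5.2)) and Prop. 4.1] -/
theorem SchrammSmirnov2011_lemma_5_1.exists_measurableSet_crossingField_ae_eq_of_gluing
    (h51 : SchrammSmirnov2011_lemma_5_1) (h14 : SchrammSmirnov2011_thm_1_4) (hD : IsOpen D)
    (hne : D.Nonempty)
    {μ : FiniteMeasure (QuadConfig D)} {δs : ℕ → ℝ} (hpos : ∀ k, 0 < δs k)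
    (h0 : Tendsto δs atTop (𝓝 0))
    (hlim : Tendsto (fun k => squareCrossingLaw D (δs k)) atTop (𝓝 μ))
    {U : Set ℂ} (Q₀ : Quad D)
    (h41 : ∀ ε : ℝ, 0 < ε → ∃ (F : Set (Quad D)) (W : Set (QuadConfig D)), F.Finite ∧
      (∀ Q ∈ F, Q.carrier ⊆ U) ∧
      MeasurableSet[MeasurableSpace.generateFrom ((fun Q => QuadConfig.crossedEvent Q) '' F)] W ∧
      limsup (fun k => (squareCrossingLaw D (δs k) : Measure (QuadConfig D))
        (W ∆ QuadConfig.crossedEvent Q₀)) atTop ≤ ENNReal.ofReal ε) :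
    ∃ t, MeasurableSet[crossingField U] t ∧
      QuadConfig.crossedEvent Q₀ =ᵐ[(μ : Measure (QuadConfig D))] t := by
  refine exists_measurableSet_ae_eq_of_forall_approx fun ε hε => ?_
  obtain ⟨F, W, hF, hFU, hW, hlimsup⟩ := h41 ε hε
  refine ⟨W, ?_, ?_⟩
  · -- `σ(⊞_Q : Q ∈ F) ≤ 𝓕_U`
    refine (MeasurableSpace.generateFrom_mono ?_) W hW
    rintro _ ⟨Q, hQ, rfl⟩
    exact ⟨Q, hFU Q hQ, rfl⟩
  · -- Cor. 5.2 in `σ(⊞_Q : Q ∈ F ∪ {Q₀})`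
    have hmeas : MeasurableSet[MeasurableSpace.generateFrom
        ((fun Q => QuadConfig.crossedEvent Q) '' insert Q₀ F)]
          (QuadConfig.crossedEvent Q₀ ∆ W) := by
      refine MeasurableSet.symmDiff
        (MeasurableSpace.measurableSet_generateFrom ⟨Q₀, mem_insert _ _, rfl⟩) ?_
      exact MeasurableSpace.generateFrom_mono (image_mono (subset_insert _ _)) W hW
    have ht := h51.tendsto_measure h14 hD hne hpos h0 hlim (hF.insert Q₀) hmeas
    rw [← ht.limsup_eq, symmDiff_comm]
    exact hlimsup

end QuadCrossing

end Literature.Probability.Percolation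

end
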